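import Summits.BirchSwinnertonDyer.BirchSwinnertonDyer.Theorems.PrintX11aMuCertGivesConjA
import Summits.BirchSwinnertonDyer.BirchSwinnertonDyer.Theorems.PrintX11aNonSurjMuAnHardDefs
import Summits.BirchSwinnertonDyer.BirchSwinnertonDyer.Theorems.PrintX11aUpperNonSurjThreeMultDivisibilityAtOfConjA
import Summits.BirchSwinnertonDyer.BirchSwinnertonDyer.Theorems.ErratumRoadFiveNonSurjCornerTwinKatoEngine
import Summits.BirchSwinnertonDyer.BirchSwinnertonDyer.Theses.PrintX11a
import Summits.BirchSwinnertonDyer.BirchSwinnertonDyer.Theses.ErratumRoadFive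
import HarnessLib

/-!
# ROAD DOMINANCE on the cruxes `PrintX11a.UpperNonSurjFive` (stmt-BirchSwinnertonDyer-20614) ∕ `…Three` (…-20613), line level:
# `stub_muAnHardFive ⟹ stub_conjA_five` and `stub_muAnHardThree ⟹ stub_conjA_three` (modulo three displayed named facts),
# and the μ-road's composition re-derived THROUGH the (A)-road

Seat `bsd-line-x11a-p3` (LEAD of line «finemu5»); `--supports stmt-BirchSwinnertonDyer-20614`.  Part 2 of
`Theorems/PrintX11aMuCertGivesConjA.lean` (the Theses-free per-pair theorem «analytic certificate ⟹ statement (A)»); this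
part only instantiates it on the registered stub TEXTS, so it lives in the cone of the route files.  Theorems only;
CONDITIONAL; no definition, no named fact, no `sorry`; nothing asserted about any curve; PARTITION 0; BSD is not proved by
any of this.

CONSEQUENCE FOR THE LINES.  «finemu5» (and «finemu3») register two open inputs — `stub_conjA_five` (statement (A) on the
U5 domain) and `stub_muAnHardFive` (= `Theorems.X11aNonSurjMuAnHardFive`, the analytic `μ = 0` certificate on the hard
sub-locus).  By `conjAFive_of_muAnHardFive_of_facts` the second implies the first modulo F1-mult
(`Kato2004.exists_multDivisibilityInputs_fine`), Wuthrich 2014 Cor. 18 and modularity (`hpar`, `hmod`) — all three already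
conjuncts of the lines' fact stub `KatoTwinFactsFiveAn`.  So statement (A) is THE load-bearing open input of both lines
(the weaker of the two), and the μ-road composition `UpperNonSurjFive_of_muRoad` factors through the (A)-road
(`upperNonSurjFive_of_muAnHardFive_via_conjA`).

References: [CoatesSujatha2005] §3 statement (A); [GreenbergLNM1716] Conj. 1.11, §4 (p. 113); [Kato2004Asterisque] §17.13
(pp. 279–280); [Wuthrich2014] Cor. 18 (p. 398); tree `Theorems/PrintX11aMuCertGivesConjA.lean`,
`Theorems/PrintX11aNonSurjMuAnHardDefs.lean`, `Theorems/PrintX11aUpperNonSurjThreeMultDivisibilityAtOfConjA.lean`,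
`Cruxes/UpperNonSurjFive/Lines/finemu5.lean`.
-/

set_option autoImplicit false
set_option linter.dupNamespace false

noncomputable section

open scoped Classical NumberField MatrixGroups ModularForm
open CongruenceSubgroup WeierstrassCurve Field
open Literature.NumberTheory.EllipticCurves Literature.NumberTheory.EllipticCurves.ModularForms
open Literature.NumberTheory.EllipticCurves.Kato2004
open Literature.NumberTheory.EllipticCurves.Rank1Residual Literature.NumberTheory.EllipticCurves.Rank1Residual.Typed
open Literature.NumberTheory.EllipticCurves.Wuthrich2014 Literature.NumberTheory.EllipticCurves.SteinWuthrich2013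
open Literature.NumberTheory.EllipticCurves.Greenberg1999

namespace Summit.BirchSwinnertonDyer.BirchSwinnertonDyer.Theorems

open Summit.BirchSwinnertonDyer.Rank1Residual Summit.BirchSwinnertonDyer.Rank1Residual.X11b

/-- **ROAD DOMINANCE on line «finemu5» (crux U5, item 20614): `stub_muAnHardFive ⟹ stub_conjA_five`** — the registered
μ-road stub `Theorems.X11aNonSurjMuAnHardFive` implies the (A)-road stub's statement `∀ W p, ClassX11a W p → ¬ Surj W p →
5 ≤ p → ConjAAt W p`, modulo F1-mult, Wuthrich Cor. 18 and modularity (`hpar`, `hmod`).  So statement (A) on U5 is the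
WEAKER of the line's two open inputs.  CONDITIONAL; closes nothing. [cite: CoatesSujatha2005, §3 statement (A)]
[cite: GreenbergLNM1716, Conj. 1.11 and §4 (PDF p. 113)] [cite: Kato2004Asterisque, §17.13 (pp. 279–280)] -/
theorem conjAFive_of_muAnHardFive_of_facts (hH : X11aNonSurjMuAnHardFive)
    (hfine : Kato2004.exists_multDivisibilityInputs_fine)
    (h18 : Wuthrich2014.corollary18_padicLFunction_mem_iwasawaAlgebra_multiplicative)
    (hpar : nonempty_modularParametrizationData) (hmod : hasEntireLFunction_rat) :
    ∀ (W : WeierstrassCurve ℚ) [W.IsElliptic] [W.IsGloballyMinimal] (p : ℕ) [Fact p.Prime],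
      ClassX11a W p → ¬ Surj W p → 5 ≤ p → ConjAAt W p :=
  fun W _ _ p _ hX hns hp5 =>
    hX.conjAAt_of_muAnHard_of_not_surj hfine h18 hpar hmod hns (fun hhard => hH W p hX hns hp5 hhard)

/-- **ROAD DOMINANCE on line «finemu3» (crux U3, item 20613): `stub_muAnHardThree ⟹ stub_conjA_three`**, modulo the same
three facts. CONDITIONAL; closes nothing. [cite: CoatesSujatha2005, §3 statement (A)] [cite: GreenbergLNM1716, Conj. 1.11]
[cite: Kato2004Asterisque, §17.13 (pp. 279–280)] -/
theorem conjAThree_of_muAnHardThree_of_facts (hH : X11aNonSurjMuAnHardThree)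
    (hfine : Kato2004.exists_multDivisibilityInputs_fine)
    (h18 : Wuthrich2014.corollary18_padicLFunction_mem_iwasawaAlgebra_multiplicative)
    (hpar : nonempty_modularParametrizationData) (hmod : hasEntireLFunction_rat) :
    ∀ (W : WeierstrassCurve ℚ) [W.IsElliptic] [W.IsGloballyMinimal] (p : ℕ) [Fact p.Prime],
      ClassX11a W p → ¬ Surj W p → p = 3 → ConjAAt W p :=
  fun W _ _ p _ hX hns hp3 =>
    hX.conjAAt_of_muAnHard_of_not_surj hfine h18 hpar hmod hns (fun hhard => hH W p hX hns hp3 hhard)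

/-- **Consequently the μ-road's composition FACTORS through the (A)-road**: `X11aNonSurjMuAnHardFive` and the K2 bundle
`KatoTwinFactsFiveAn` give the crux `Theses.PrintX11a.UpperNonSurjFive` via (A) on U5 and the landed transfer — the
skeleton's `UpperNonSurjFive_of_muRoad` re-derived through `stub_conjA_five`'s statement.  CONDITIONAL; closes nothing.
[cite: Kato2004Asterisque, §17.13 (pp. 279–280)] [cite: CoatesSujatha2005, §3 statement (A)] -/
theorem upperNonSurjFive_of_muAnHardFive_via_conjA (hH : X11aNonSurjMuAnHardFive)
    (hF : Theses.ErratumRoadFive.KatoTwinFactsFiveAn) : Theses.PrintX11a.UpperNonSurjFive := by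
  obtain ⟨-, -, -, hGZK, hmod, -, hpar, -, -, -, -, hJs, hJn, hGS, -, -, hne, h12, hnsI, hspI, h15, h18,
    hfine⟩ := hF
  intro W _ _ p _ hX hns hp5
  exact missingUpperBoundAt_of_classX11a_of_multDivisibilityAt hJs hJn hGZK hmod hpar W p (hGS W p) hX
    (stub_multDivisibilityAt_of_conjA hne h12 hnsI hspI h15 h18 hfine W p hX.2.1 hX.2.2.1 hX.2.2.2.1
      (conjAFive_of_muAnHardFive_of_facts hH hfine h18 hpar hmod W p hX hns hp5))

end Summit.BirchSwinnertonDyer.BirchSwinnertonDyer.Theorems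

end
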